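import Mathlib
import Literature.NumberTheory.LFunctions.WeilMellinInversion
import Literature.Analysis.FunctionSpaces.PlancherelL1L2
import HarnessLib

/-!
# Theta profiles in the Weil–Mellin currency: `weilMellin (e^{x/2}Θ(eˣ)) = mellin Θ`, the odd profile at a zero pair, and
# integration by parts WITHOUT compact support (RH-FREE)

WEIL column (LADDER-RH, W-P(P2); crux `ThetaCertificateSound` behind `UCRange157To60000`, director 2026-08-25T22:44Z); steps
(Z4a) and (Z2-core) of cc-s2-3's WEIL-THEORY-R3 §3′/§3‴, companion of `Theorems/WeilColumnThetaMellin.lean` (p411028,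
a57d4a247af6: `mellin Θ_G ρ = 0` at the nontrivial zeros for Lipschitz profiles with `∫ G = 0`).
* `weilMellin_expProfile` — for ANY `Θ : ℝ → ℂ` and `s`, the tree's additive-variable transform of `G₀(x) = e^{x/2} Θ(eˣ)` IS
  `mellin Θ s` (substitution `u = eˣ`; unconditional); `integrable_expProfile_iff` — integrability of the Weil–Mellin integrand
  ⟺ `MellinConvergent Θ s`; `weilMellin_expProfile_comp_neg` — the reflected profile gives `mellin Θ (1 − s)`.
* `weilMellin_oddProfile`, `weilMellin_oddProfile_eq_zero` — the ODD profile `G₀⁻ = G₀ − G₀(−·)` (PART XIX.1) has transform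
  `mellin Θ s − mellin Θ (1 − s)`, hence `0` at a pair `ρ, 1 − ρ` of zeros of `mellin Θ` (with p411028: at every nontrivial zero
  of `ζ`, since `1 − ρ` is again one, `GeneralizedRH.riemannZeta_one_sub_eq_zero`).
* `weilMellin_hasDerivAt_of_integrable`, `norm_weilMellin_le_of_deriv` — ONE integration by parts for a differentiable,
  NOT necessarily compactly supported `T` under integrability hypotheses: `(T')^(s) = −(s − ½) T̂(s)` and
  `‖T̂(s)‖ ≤ (∫ ‖T'‖ e^{(Re s − ½)t}) / ‖s − ½‖` — the decay of the cut tail `T = G₀(1 − χ)` that, with the tree's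
  `tsum_zeroOrder_div_norm_sq_lt` (Σ m(ρ)/|ρ|² < 0.0462) and `re_weilQuadratic_le_of_zeroSum_le`, bounds `Q_F(g⁻)` by an
  explicit multiple of `(∫‖T'‖e^{(σ−½)t})²` (R3 §3‴ (Z2)).
UPPER-clause technology only; nothing here bears on the truth of RH. References: E. Bombieri, Rend. Lincei (9) 11 (2000) §2
(`Bombieri2000Weil`, the transform and `f̃*(s) = f̃(1 − s)`); handoff-idea-2 PART XIX (HOME/handoff/IDEAS-explicit-sieve.md).
-/

set_option linter.dupNamespace false

noncomputable section

open MeasureTheory Set Complex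
open Literature.NumberTheory.LFunctions

namespace Summit.RiemannHypothesis.RiemannHypothesis.Theorems.WeilColumn.ThetaMellin

/-- The additive-variable profile of a multiplicative function: `G₀(x) = e^{x/2} Θ(eˣ)` (PART XIX.1's `G₀` for `Θ` a theta series). -/
def expProfile (Θ : ℝ → ℂ) (x : ℝ) : ℂ := (Real.exp (x / 2) : ℂ) * Θ (Real.exp x)

/-- `e^{x/2} · e^{(s − 1/2) x} = (eˣ)^{s-1} · eˣ` as complex numbers (`x` real). [folklore] -/
theorem exp_half_mul_cexp (x : ℝ) (s : ℂ) :
    (Real.exp (x / 2) : ℂ) * cexp ((s - 1 / 2) * x) = ((Real.exp x : ℝ) : ℂ) ^ (s - 1) * (Real.exp x : ℂ) := by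
  rw [Complex.ofReal_exp, Complex.ofReal_exp, cpow_def_of_ne_zero (Complex.exp_ne_zero _),
    Complex.log_exp (by simp [Real.pi_pos]) (by simpa using Real.pi_nonneg), ← Complex.exp_add, ← Complex.exp_add]
  congr 1
  push_cast
  ring

/-- **`weilMellin (e^{x/2} Θ(eˣ)) s = mellin Θ s`** for every `Θ` and every `s` (substitution `u = eˣ`). [folklore] -/
theorem weilMellin_expProfile (Θ : ℝ → ℂ) (s : ℂ) : weilMellin (expProfile Θ) s = mellin Θ s := by
  rw [weilMellin, mellin, Literature.Analysis.FunctionSpaces.integral_Ioi_eq_integral_exp_neg_smul,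
    ← integral_neg_eq_self]
  refine integral_congr_ae (Filter.Eventually.of_forall fun x => ?_)
  simp only [expProfile, smul_eq_mul, Complex.real_smul]
  rw [mul_assoc, mul_comm (Θ _), ← mul_assoc, exp_half_mul_cexp]
  ring


/-- Integrability transfer: the Weil–Mellin integrand of `e^{x/2} Θ(eˣ)` at `s` is integrable iff `Θ` is Mellin-summable at `s`. [folklore] -/
theorem integrable_expProfile_iff (Θ : ℝ → ℂ) (s : ℂ) :
    Integrable (fun x : ℝ => expProfile Θ x * cexp ((s - 1 / 2) * x)) ↔ MellinConvergent Θ s := by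
  have key : ∀ x : ℝ, expProfile Θ x * cexp ((s - 1 / 2) * x) =
      Real.exp x • ((((Real.exp x : ℝ) : ℂ) ^ (s - 1)) • Θ (Real.exp x)) := by
    intro x
    calc expProfile Θ x * cexp ((s - 1 / 2) * x)
        = ((Real.exp (x / 2) : ℂ) * cexp ((s - 1 / 2) * x)) * Θ (Real.exp x) := by unfold expProfile; ring
      _ = ((((Real.exp x : ℝ) : ℂ) ^ (s - 1)) * (Real.exp x : ℂ)) * Θ (Real.exp x) := by rw [exp_half_mul_cexp]
      _ = Real.exp x • ((((Real.exp x : ℝ) : ℂ) ^ (s - 1)) • Θ (Real.exp x)) := by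
          rw [smul_eq_mul, Complex.real_smul]; ring
  rw [MellinConvergent, Literature.Analysis.FunctionSpaces.integrableOn_Ioi_iff_integrable_exp_neg_smul]
  constructor
  · intro h
    refine (h.comp_neg).congr (Filter.Eventually.of_forall fun x => ?_)
    exact key (-x)
  · intro h
    refine (h.comp_neg).congr (Filter.Eventually.of_forall fun x => ?_)
    simp only [neg_neg]
    exact (key x).symm

/-- The reflected profile: `weilMellin (x ↦ e^{-x/2} Θ(e^{-x})) s = mellin Θ (1 - s)`. [folklore] -/
theorem weilMellin_expProfile_comp_neg (Θ : ℝ → ℂ) (s : ℂ) :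
    weilMellin (fun x : ℝ => expProfile Θ (-x)) s = mellin Θ (1 - s) := by
  rw [weilMellin_comp_neg, weilMellin_expProfile]

/-- The ODD profile `G₀⁻(x) = G₀(x) − G₀(−x)` of PART XIX (before the cut `χ`). -/
def oddProfile (Θ : ℝ → ℂ) (x : ℝ) : ℂ := expProfile Θ x - expProfile Θ (-x)

/-- `weilMellin G₀⁻ s = mellin Θ s − mellin Θ (1 − s)` whenever `Θ` is Mellin-summable at `s` and at `1 − s`. [folklore] -/
theorem weilMellin_oddProfile (Θ : ℝ → ℂ) {s : ℂ} (h1 : MellinConvergent Θ s) (h2 : MellinConvergent Θ (1 - s)) :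
    weilMellin (oddProfile Θ) s = mellin Θ s - mellin Θ (1 - s) := by
  have i1 : Integrable (fun x : ℝ => expProfile Θ x * cexp ((s - 1 / 2) * x)) := (integrable_expProfile_iff Θ s).2 h1
  have i2 : Integrable (fun x : ℝ => expProfile Θ (-x) * cexp ((s - 1 / 2) * x)) := by
    have h := ((integrable_expProfile_iff Θ (1 - s)).2 h2).comp_neg
    refine h.congr (Filter.Eventually.of_forall fun x => ?_)
    simp only [Complex.ofReal_neg]
    congr 1
    congr 1
    ring
  rw [← weilMellin_expProfile Θ s, ← weilMellin_expProfile_comp_neg Θ s, weilMellin, weilMellin, weilMellin,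
    ← integral_sub i1 i2]
  refine integral_congr_ae (Filter.Eventually.of_forall fun x => ?_)
  simp only [oddProfile]
  ring

/-- **The odd theta profile's transform vanishes at a zero pair.** If `mellin Θ` vanishes at `ρ` and at `1 − ρ` (both nontrivial
zeros of `ζ` when one is: `GeneralizedRH.riemannZeta_one_sub_eq_zero`), then `weilMellin G₀⁻ ρ = 0` — the input that makes the cut
witness's transform equal to minus the tail's at every zero. [this seat, R3 §3′ (Z1)/(Z4a)] -/
theorem weilMellin_oddProfile_eq_zero (Θ : ℝ → ℂ) {ρ : ℂ} (h1 : MellinConvergent Θ ρ) (h2 : MellinConvergent Θ (1 - ρ))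
    (hz : mellin Θ ρ = 0) (hz' : mellin Θ (1 - ρ) = 0) : weilMellin (oddProfile Θ) ρ = 0 := by
  rw [weilMellin_oddProfile Θ h1 h2, hz, hz', sub_zero]


/-! ## (Z2-core) One integration by parts WITHOUT compact support: `(T')^(s) = −(s − ½) T̂(s)` and the decay bound -/

/-- **Integration by parts for the Weil–Mellin transform of a NON-compactly-supported `C¹` function** (the cut tail `T = G₀(1−χ)`
of PART XIX decays exponentially but is not compactly supported, so the tree's `weilMellin_deriv` for `IsWeilTest` does not apply):
if `T` is differentiable with derivative `T'`, and the three integrands `T·e^{(s−½)t}`, `T'·e^{(s−½)t}` are integrable, then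
`weilMellin T' s = −(s − ½) · weilMellin T s`. [folklore; Mathlib `integral_mul_deriv_eq_deriv_mul_of_integrable`] -/
theorem weilMellin_hasDerivAt_of_integrable {T T' : ℝ → ℂ} (hT : ∀ x : ℝ, HasDerivAt T (T' x) x) (s : ℂ)
    (h1 : Integrable (fun t : ℝ => T t * cexp ((s - 1 / 2) * t)))
    (h2 : Integrable (fun t : ℝ => T' t * cexp ((s - 1 / 2) * t))) :
    weilMellin T' s = -(s - 1 / 2) * weilMellin T s := by
  unfold weilMellin
  set w : ℂ := s - 1 / 2 with hw
  have hu : ∀ t : ℝ, HasDerivAt (fun t : ℝ => cexp (w * t)) (w * cexp (w * t)) t := by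
    intro t
    have e1 : HasDerivAt (fun t : ℝ => w * (t : ℂ)) (w * 1) t :=
      (Complex.ofRealCLM.hasDerivAt.const_mul w).congr_deriv (by simp)
    have e2 := (Complex.hasDerivAt_exp (w * t)).comp t e1
    simpa [mul_comm, Function.comp_def] using e2
  have key := integral_mul_deriv_eq_deriv_mul_of_integrable (u := fun t : ℝ => cexp (w * t))
    (u' := fun t : ℝ => w * cexp (w * t)) (v := T) (v' := T')
    (fun t _ => hu t) (fun t _ => hT t) ?_ ?_ ?_
  · calc ∫ t : ℝ, T' t * cexp (w * t) = ∫ t : ℝ, cexp (w * t) * T' t := by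
          congr 1 with t; ring
      _ = -∫ t : ℝ, w * cexp (w * t) * T t := key
      _ = -w * ∫ t : ℝ, T t * cexp (w * t) := by
          rw [neg_mul, ← integral_const_mul]
          congr 2 with t; ring
  · exact h2.congr (Filter.Eventually.of_forall fun t => by simp [mul_comm])
  · exact (h1.const_mul w).congr (Filter.Eventually.of_forall fun t => by simp [Pi.mul_apply]; ring)
  · exact h1.congr (Filter.Eventually.of_forall fun t => by simp [mul_comm])

/-- **DECAY FROM ONE DERIVATIVE**: under the same hypotheses and `s ≠ ½`,
`‖T̂(s)‖ ≤ (∫ ‖T'(t)‖ e^{(Re s − ½) t} dt) / ‖s − ½‖`. For the zeros of `ζ` (`|Im ρ| > 14`, tree `fourteen_lt_abs_im`) this is the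
`W(σ)/|ρ − ½|` bound of WEIL-THEORY-R3 §3‴ (Z2). [folklore] -/
theorem norm_weilMellin_le_of_deriv {T T' : ℝ → ℂ} (hT : ∀ x : ℝ, HasDerivAt T (T' x) x) {s : ℂ} (hs : s ≠ 1 / 2)
    (h1 : Integrable (fun t : ℝ => T t * cexp ((s - 1 / 2) * t)))
    (h2 : Integrable (fun t : ℝ => T' t * cexp ((s - 1 / 2) * t))) :
    ‖weilMellin T s‖ ≤ (∫ t : ℝ, ‖T' t‖ * Real.exp ((s.re - 1 / 2) * t)) / ‖s - 1 / 2‖ := by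
  have hw : s - 1 / 2 ≠ 0 := sub_ne_zero.mpr hs
  have hwpos : 0 < ‖s - 1 / 2‖ := norm_pos_iff.mpr hw
  rw [le_div_iff₀ hwpos]
  have h := weilMellin_hasDerivAt_of_integrable hT s h1 h2
  have hn : ‖weilMellin T' s‖ = ‖s - 1 / 2‖ * ‖weilMellin T s‖ := by
    rw [h, norm_mul, norm_neg]
  have hb : ‖weilMellin T' s‖ ≤ ∫ t : ℝ, ‖T' t‖ * Real.exp ((s.re - 1 / 2) * t) := by
    unfold weilMellin
    refine (norm_integral_le_integral_norm _).trans (le_of_eq ?_)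
    congr 1 with t
    rw [norm_mul, Complex.norm_exp]
    congr 1
    simp [Complex.mul_re, Complex.sub_re]
  calc ‖weilMellin T s‖ * ‖s - 1 / 2‖ = ‖weilMellin T' s‖ := by rw [hn, mul_comm]
    _ ≤ _ := hb

end Summit.RiemannHypothesis.RiemannHypothesis.Theorems.WeilColumn.ThetaMellin
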